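import Mathlib
import Literature.Analysis.OperatorTheory.ContractiveDeterminantalRepresentation
import Literature.Analysis.OperatorTheory.ContractiveDeterminantalRepresentationProofs
import Literature.Analysis.OperatorTheory.ContractiveDetReflectionIdentity

/-!
# Stub `stub_realizationRename` of crux `ContractivityPrice.ContractiveHardness`
# (line `registered` = birth skeleton `Cruxes/ContractiveHardness/Lines/birth.lean`, reshape 4)

Functoriality of transfer-function realizations along colourings.  A realization
`num/den = A + B Z_{κ'} (I − D Z_{κ'})⁻¹ C` (`IsRealizedBy κ' U num den`, cleared denominators)
over `ℂ[z_1, …, z_R]` pushes forward along any colouring `κ : Fin R → σ` of the variables: the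
algebra map `rename κ : ℂ[z_1, …, z_R] → ℂ[z]` sends the block variable matrix `Z_{κ'}` to
`Z_{κ ∘ κ'}`, fixes the constant blocks `A, B, C, D` of `U`, and commutes with `det`, `adjugate`
and matrix products, so the SAME matrix `U` realizes `rename κ num / rename κ den` with block
structure `κ ∘ κ'` (`isRealizedBy_rename`).  For the pencil determinant
`p₀ = det(I − K Z_{id})` (one fresh variable per row of `K`) and its reflection
`z^𝟙 p̄₀(1/z) = det(Z_{id} − K^*)` (GKVW (5.5), `conjReverse_blockOrder_gkvwDet`) the images are
`p = det(I − K Z_κ) = gkvwDet κ K` (`gkvwDet_eq_rename`) and `det(Z_κ − K^*) = z^n p̄(1/z)`,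
`n = blockOrder κ` (`rename_conjReverse_blockOrder_gkvwDet`), which is the registered stub.

Contents: `map_C_map_rename`, `blockVar_map_rename`, `pencil_map_rename` (bookkeeping),
`isRealizedBy_rename` (the push-forward), `rename_conjReverse_blockOrder_gkvwDet`, and the
registered stub `stub_realizationRename`.
-/

noncomputable section

namespace Summit.ValiantsHypothesis.ValiantsHypothesis.Theorems

open MvPolynomial Matrix Literature.Analysis.OperatorTheory

set_option linter.dupNamespace false

/-- Renaming variables fixes a matrix of constants: `(M.map C).map (rename κ) = M.map C`.
[folklore] -/
theorem map_C_map_rename {τ σ : Type*} {m n : Type*} (κ : τ → σ) (M : Matrix m n ℂ) :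
    (M.map (C : ℂ → MvPolynomial τ ℂ)).map (rename κ) = M.map (C : ℂ → MvPolynomial σ ℂ) := by
  ext i j
  simp

/-- Renaming variables along `κ` sends the block variable matrix `Z_{κ'} = diag(z_{κ' i})` to
`Z_{κ ∘ κ'}`. [folklore] -/
theorem blockVar_map_rename {τ σ : Type*} {R' : ℕ} (κ : τ → σ) (κ' : Fin R' → τ) :
    (blockVar κ').map (rename κ) = blockVar (κ ∘ κ') := by
  ext i j
  simp only [Matrix.map_apply, blockVar_apply, Function.comp_apply]
  split_ifs <;> simp

/-- Renaming variables along `κ` sends the state pencil `I − D Z_{κ'}` (constant `D`) to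
`I − D Z_{κ ∘ κ'}`. [folklore] -/
theorem pencil_map_rename {τ σ : Type*} {R' : ℕ} (κ : τ → σ) (κ' : Fin R' → τ)
    (D : Matrix (Fin R') (Fin R') ℂ) :
    (1 - D.map (C : ℂ → MvPolynomial τ ℂ) * blockVar κ').map (rename κ) =
      1 - D.map (C : ℂ → MvPolynomial σ ℂ) * blockVar (κ ∘ κ') := by
  rw [Matrix.map_sub _ (map_sub (rename κ : MvPolynomial τ ℂ →ₐ[ℂ] MvPolynomial σ ℂ)),
    Matrix.map_one _ (map_zero _) (map_one _), Matrix.map_mul, map_C_map_rename,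
    blockVar_map_rename]

/-- **Realizations push forward along colourings.** If `U = [[A, B], [C, D]]` realizes `num/den`
with block structure `κ'` (`num · det(I − D Z_{κ'}) = den · (A det(I − D Z_{κ'}) +
(B Z_{κ'} adj(I − D Z_{κ'}) C)₀₀)` in `ℂ[z_τ]`), then the same `U` realizes
`rename κ num / rename κ den` with block structure `κ ∘ κ'`: apply the ring map `rename κ`, which
fixes the constant blocks, maps `Z_{κ'}` to `Z_{κ ∘ κ'}` and commutes with `det`, `adjugate` and
products. [folklore] -/
theorem isRealizedBy_rename {τ σ : Type*} {R' : ℕ} (κ : τ → σ) (κ' : Fin R' → τ)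
    (U : Matrix (Fin 1 ⊕ Fin R') (Fin 1 ⊕ Fin R') ℂ) {num den : MvPolynomial τ ℂ}
    (h : IsRealizedBy κ' U num den) :
    IsRealizedBy (κ ∘ κ') U (rename κ num) (rename κ den) := by
  have h0 := h
  unfold IsRealizedBy at h0 ⊢
  dsimp only at h0 ⊢
  have h' := congrArg (rename κ) h0
  simp only [map_mul, map_add] at h'
  rw [AlgHom.map_det, AlgHom.mapMatrix_apply, pencil_map_rename] at h'
  have hA : rename κ (((U.toBlocks₁₁).map (C : ℂ → MvPolynomial τ ℂ)) 0 0) =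
      ((U.toBlocks₁₁).map (C : ℂ → MvPolynomial σ ℂ)) 0 0 := by
    simp
  have hBmat : ((U.toBlocks₁₂).map (C : ℂ → MvPolynomial τ ℂ) * blockVar κ' *
        (1 - (U.toBlocks₂₂).map (C : ℂ → MvPolynomial τ ℂ) * blockVar κ').adjugate *
        (U.toBlocks₂₁).map (C : ℂ → MvPolynomial τ ℂ)).map (rename κ) =
      (U.toBlocks₁₂).map (C : ℂ → MvPolynomial σ ℂ) * blockVar (κ ∘ κ') *
          (1 - (U.toBlocks₂₂).map (C : ℂ → MvPolynomial σ ℂ) * blockVar (κ ∘ κ')).adjugate *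
        (U.toBlocks₂₁).map (C : ℂ → MvPolynomial σ ℂ) := by
    have hadj := AlgHom.map_adjugate (rename κ : MvPolynomial τ ℂ →ₐ[ℂ] MvPolynomial σ ℂ)
      (1 - (U.toBlocks₂₂).map (C : ℂ → MvPolynomial τ ℂ) * blockVar κ')
    rw [AlgHom.mapMatrix_apply, AlgHom.mapMatrix_apply, pencil_map_rename] at hadj
    rw [Matrix.map_mul, Matrix.map_mul, Matrix.map_mul, map_C_map_rename, map_C_map_rename,
      blockVar_map_rename, hadj]
  have hB := congrFun (congrFun hBmat 0) 0
  rw [Matrix.map_apply] at hB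
  rw [hA, hB] at h'
  exact h'

/-- Renaming along `κ` sends the reflection `z^𝟙 p̄₀(1/z) = det(Z_{id} − K^*)` of the pencil
determinant `p₀ = det(I − K Z_{id})` (one variable per row) to the reflection
`z^n p̄(1/z) = det(Z_κ − K^*)` of `p = det(I − K Z_κ)`, `n = blockOrder κ` (GKVW (5.5) on both
sides). [folklore] -/
theorem rename_conjReverse_blockOrder_gkvwDet {σ : Type*} {R : ℕ} (κ : Fin R → σ)
    (K : Matrix (Fin R) (Fin R) ℂ) :
    rename κ (conjReverse (blockOrder (id : Fin R → Fin R)) (gkvwDet (id : Fin R → Fin R) K)) =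
      conjReverse (blockOrder κ) (gkvwDet κ K) := by
  rw [conjReverse_blockOrder_gkvwDet, conjReverse_blockOrder_gkvwDet, AlgHom.map_det,
    AlgHom.mapMatrix_apply]
  congr 1
  ext i j
  simp only [Matrix.map_apply, Matrix.sub_apply, blockVar_apply, map_sub, rename_C, id_eq]
  split_ifs <;> simp

/-- **Registered stub `stub_realizationRename`** (line `registered`/birth of crux
`ContractivityPrice.ContractiveHardness`, reshape 4): a realization of `z^𝟙 p̄₀(1/z)/p₀` for the
tautological block structure (`p₀ = gkvwDet id K`) with block structure `κ' : Fin R' → Fin R`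
pushes forward along any colouring `κ : Fin R → σ` to a realization of
`z^{blockOrder κ} p̄(1/z)/p`, `p = gkvwDet κ K = rename κ p₀`, with block structure `κ ∘ κ'` and the
same `U` (`isRealizedBy_rename`, `gkvwDet_eq_rename`, `rename_conjReverse_blockOrder_gkvwDet`).
[folklore] -/
theorem stub_realizationRename :
    ∀ (R R' : ℕ) {σ : Type} (κ : Fin R → σ) (K : Matrix (Fin R) (Fin R) ℂ) (κ' : Fin R' → Fin R)
      (U : Matrix (Fin 1 ⊕ Fin R') (Fin 1 ⊕ Fin R') ℂ),
      IsRealizedBy κ' U (conjReverse (blockOrder (id : Fin R → Fin R)) (gkvwDet (id : Fin R → Fin R) K))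
          (gkvwDet (id : Fin R → Fin R) K) →
      IsRealizedBy (κ ∘ κ') U (conjReverse (blockOrder κ) (gkvwDet κ K)) (gkvwDet κ K) := by
  intro R R' σ κ K κ' U h
  have key := isRealizedBy_rename κ κ' U h
  rw [rename_conjReverse_blockOrder_gkvwDet, ← gkvwDet_eq_rename] at key
  exact key

end Summit.ValiantsHypothesis.ValiantsHypothesis.Theorems

end
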